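import Mathlib
import Summits.ResolutionOfSingularities.ResolutionOfSingularities.Theorems.WildQuotientsWildQuotientResolutionS1W1NTypeN

/-!
# S1 / W1N cascade — Part Vb: the three orientations of a type-N node at chart 1 at 0, and the first step from an arbitrary type-N node

Crux stmt-ResolutionOfSingularities-17941 (`WildQuotients.CyclicQuotientFourfolds`), S1a line `s1a-logminvertex`,
stub `stub_W1N_print`, sub-line `w1n-cascade` (idea-1 `W1N-LINE.md`; proofs from `CombinedW1NPrint.scratch.lean`
f33256b0cfc42851).  [OURS · L1 W4.5c] — NOT a statement of the manuscript; counted 0 post-V5.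

`sheared_chart1_zero_step` (sheared type N: the chart-1-at-0 successor is bad, `3 ≤ μ' ≤ μ + 1`,
`linearPart θ' = [[0,0],[b₂₀,0]]`), the two non-bad orientations, `typeN_chart1_zero_step` (a bad successor forces
the sheared orientation) and `typeN_step` (B3 transport).
-/

-- single-problem summit: the doubled namespace component `ResolutionOfSingularities` is forced
set_option linter.dupNamespace false

noncomputable section

open MvPowerSeries IsLocalRing
open Literature.AlgebraicGeometry.Resolution
open Summit.ResolutionOfSingularities.ResolutionOfSingularities.Theorems.WildCones.MuDropCharTwoOrdP

namespace Summit.ResolutionOfSingularities.ResolutionOfSingularities.Theorems.WildQuotientResolution.S1.PlanarField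

variable {κ : Type} [Field κ]

/-! ### The three orientations of a type-N node at chart 1 at 0 -/

/-- SHEARED TYPE N (`a₁₀ = b₁₀ = b₀₁ = 0 ≠ a₀₁`), chart 1 at 0: the isolated successor `θ' = (x·A, G)` has
`fA = 1`, `eG = 2`, `μ(θ') = 1 + mb + I(A,B*)`, hence `3 ≤ μ(θ') ≤ μ(θ) + 1`, and
`linearPart θ' = [[0,0],[b₂₀,0]]` — so `θ'` IS a bad node (the unique bad successor). [OURS · L1 W4.5c] -/
theorem sheared_chart1_zero_step (θ θ' : PlanarField κ) (hiso : θ.IsIsolated) (hsing : θ.IsSingular)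
    (h00 : θ.linearPart 0 0 = 0) (h01 : θ.linearPart 0 1 ≠ 0) (h10 : θ.linearPart 1 0 = 0)
    (h11 : θ.linearPart 1 1 = 0) (hsucc : IsSuccChart1 0 θ θ') (hiso' : θ'.IsIsolated) :
    θ'.milnor ≤ θ.milnor + 1 ∧ 3 ≤ θ'.milnor ∧ θ'.IsBadNode ∧
      θ'.linearPart = !![0, 0; coeff (Finsupp.single 0 2) θ.b, 0] := by
  obtain ⟨A, Bst, G, mb, hmb, hmb1, hA, hKA, hB, hKB, hνB, hG, hKG, ha', hb', hid, hA00, hG00, hG01, hG10,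
    hfinAG, hfinAB, hμ', hF2, hF1, hF3, hF4⟩ := exists_typeN_setup θ θ' hiso hsing h01 hsucc hiso'
  rw [h00] at hA00
  rw [h10] at hG00
  rw [h11, h00, sub_zero] at hG01
  have hb10 : coeff (Finsupp.single 0 1) θ.b = 0 := by rwa [linearPart_apply_one] at h10
  have hb01 : coeff (Finsupp.single 1 1) θ.b = 0 := by rwa [linearPart_apply_one] at h11
  have hb2 : 2 ≤ θ.b.order := (FormalCoordChange.two_le_order_iff θ.b).mpr ⟨hsing.2, fun i => by
    fin_cases i
    · exact hb10
    · exact hb01⟩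
  have hmb2 : 2 ≤ mb := by rw [← hmb] at hb2; exact_mod_cast hb2
  -- `fA = 1`
  have hfA : Module.finrank κ (MvPowerSeries (Fin 2) κ ⧸ Ideal.span {A, (X 0 : MvPowerSeries (Fin 2) κ)}) = 1 := by
    obtain ⟨-, hfA'⟩ := colength_X_eq_order hKA
    have hfin : (((killCompl (⟨fun _ => (1 : Fin 2), fun a b _ => Subsingleton.elim a b⟩ : Fin 1 ↪ Fin 2) A).order.toNat
        : ℕ) : ℕ∞) = (killCompl (⟨fun _ => (1 : Fin 2), fun a b _ => Subsingleton.elim a b⟩ : Fin 1 ↪ Fin 2) A).order :=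
      ne_zero_iff_order_finite.mp hKA
    have hge : (1 : ℕ∞) ≤ (killCompl (⟨fun _ => (1 : Fin 2), fun a b _ => Subsingleton.elim a b⟩ :
        Fin 1 ↪ Fin 2) A).order :=
      one_le_order_iff_constCoeff_eq_zero.mpr (by rw [constantCoeff_killCompl, hA00])
    have h1 : 1 ≤ Module.finrank κ (MvPowerSeries (Fin 2) κ ⧸ Ideal.span {A, (X 0 : MvPowerSeries (Fin 2) κ)}) := by
      rw [Ideal.span_pair_comm, hfA']
      rw [← hfin] at hge
      exact_mod_cast hge
    omega
  -- `eG = 2`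
  have heG : Module.finrank κ (MvPowerSeries (Fin 2) κ ⧸ Ideal.span {G, (X 0 : MvPowerSeries (Fin 2) κ)}) = 2 := by
    obtain ⟨-, heG'⟩ := colength_X_eq_order hKG
    have hfin : (((killCompl (⟨fun _ => (1 : Fin 2), fun a b _ => Subsingleton.elim a b⟩ : Fin 1 ↪ Fin 2) G).order.toNat
        : ℕ) : ℕ∞) = (killCompl (⟨fun _ => (1 : Fin 2), fun a b _ => Subsingleton.elim a b⟩ : Fin 1 ↪ Fin 2) G).order :=
      ne_zero_iff_order_finite.mp hKG
    have hge : ((2 : ℕ) : ℕ∞) ≤ (killCompl (⟨fun _ => (1 : Fin 2), fun a b _ => Subsingleton.elim a b⟩ :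
        Fin 1 ↪ Fin 2) G).order := by
      refine le_order_killCompl fun k hk => ?_
      interval_cases k
      · rw [Finsupp.single_zero, coeff_zero_eq_constantCoeff_apply, hG00]
      · exact hG01
    have h2 : 2 ≤ Module.finrank κ (MvPowerSeries (Fin 2) κ ⧸ Ideal.span {G, (X 0 : MvPowerSeries (Fin 2) κ)}) := by
      rw [Ideal.span_pair_comm, heG']
      rw [← hfin] at hge
      exact_mod_cast hge
    omega
  rw [hfA, mul_one] at hF2
  rw [heG] at hμ'
  refine ⟨by omega, by omega, ?_, ?_⟩
  · -- bad: singular with nilpotent linear part `[[0,0],[b₂₀,0]]`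
    have hsing' : θ'.IsSingular := by
      constructor
      · rw [ha', map_mul, constantCoeff_X, zero_mul]
      · rw [hb', hG00]
    refine ⟨hsing', ?_⟩
    have e00 : θ'.linearPart 0 0 = 0 := by
      rw [linearPart_apply_zero, ha', coeff_single_X_mul, if_pos rfl, hA00]
    have e01 : θ'.linearPart 0 1 = 0 := by
      rw [linearPart_apply_zero, ha', coeff_single_X_mul, if_neg Fin.zero_ne_one]
    have e11 : θ'.linearPart 1 1 = 0 := by
      rw [linearPart_apply_one, hb', hG01]
    refine (isNilpotent_iff_trace_det _).mpr ⟨?_, ?_⟩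
    · rw [Matrix.trace_fin_two, e00, e11, add_zero]
    · rw [Matrix.det_fin_two, e00, e01, zero_mul, zero_mul, sub_zero]
  · have e00 : θ'.linearPart 0 0 = 0 := by
      rw [linearPart_apply_zero, ha', coeff_single_X_mul, if_pos rfl, hA00]
    have e01 : θ'.linearPart 0 1 = 0 := by
      rw [linearPart_apply_zero, ha', coeff_single_X_mul, if_neg Fin.zero_ne_one]
    have e10 : θ'.linearPart 1 0 = coeff (Finsupp.single 0 2) θ.b := by
      rw [linearPart_apply_one, hb', hG10]
    have e11 : θ'.linearPart 1 1 = 0 := by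
      rw [linearPart_apply_one, hb', hG01]
    ext i j
    fin_cases i <;> fin_cases j
    · simpa using e00
    · simpa using e01
    · simpa using e10
    · simpa using e11

/-- TYPE N WITH `a₀₁ ≠ 0` AND `a₁₀ ≠ 0` (an un-sheared direction), chart 1 at 0: the isolated successor is
NOT bad — its linear part `[[a₁₀, 0], [*, *]]` is lower-triangular with a non-zero diagonal entry.
[OURS · L1 W4.5c] -/
theorem not_isBadNode_of_linearPart_zero_zero_ne_zero (θ θ' : PlanarField κ) (hiso : θ.IsIsolated)
    (hsing : θ.IsSingular) (h01 : θ.linearPart 0 1 ≠ 0) (h00 : θ.linearPart 0 0 ≠ 0)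
    (hsucc : IsSuccChart1 0 θ θ') (hiso' : θ'.IsIsolated) : ¬ θ'.IsBadNode := by
  obtain ⟨A, Bst, G, mb, -, -, -, -, -, -, -, -, -, ha', -, -, hA00, -⟩ :=
    exists_typeN_setup θ θ' hiso hsing h01 hsucc hiso'
  rintro ⟨-, hnil⟩
  have e00 : θ'.linearPart 0 0 = θ.linearPart 0 0 := by
    rw [linearPart_apply_zero, ha', coeff_single_X_mul, if_pos rfl, hA00]
  have e01 : θ'.linearPart 0 1 = 0 := by
    rw [linearPart_apply_zero, ha', coeff_single_X_mul, if_neg Fin.zero_ne_one]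
  have hL : θ'.linearPart = !![θ.linearPart 0 0, 0; θ'.linearPart 1 0, θ'.linearPart 1 1] := by
    ext i j
    fin_cases i <;> fin_cases j
    · simpa using e00
    · simpa using e01
    · simp
    · simp
  rw [hL] at hnil
  exact h00 (diag_eq_zero_of_isNilpotent hnil).1

/-- THE LOWER ORIENTATION (`a₁₀ = a₀₁ = 0 ≠ b₁₀`), chart 1 at 0: `g = x·b − y·a` has `g₂₀ = b₁₀ ≠ 0`, so
`mg = 2`, `β = 0`, `b' = G` with `G(0,0) = b₁₀ ≠ 0`: the isolated successor is NON-SINGULAR. [OURS · L1 W4.5c] -/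
theorem not_isSingular_of_lower (θ θ' : PlanarField κ) (hiso : θ.IsIsolated) (hsing : θ.IsSingular)
    (h00 : θ.linearPart 0 0 = 0) (h01 : θ.linearPart 0 1 = 0) (h10 : θ.linearPart 1 0 ≠ 0)
    (hsucc : IsSuccChart1 0 θ θ') (hiso' : θ'.IsIsolated) : ¬ θ'.IsSingular := by
  obtain ⟨ha0, hb0⟩ := ne_zero_of_isIsolated θ hiso hsing
  have ha10 : coeff (Finsupp.single 0 1) θ.a = 0 := by rwa [linearPart_apply_zero] at h00
  have ha01 : coeff (Finsupp.single 1 1) θ.a = 0 := by rwa [linearPart_apply_zero] at h01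
  have hb10 : coeff (Finsupp.single 0 1) θ.b ≠ 0 := by rwa [linearPart_apply_one] at h10
  have h2a : 2 ≤ θ.a.order := (FormalCoordChange.two_le_order_iff θ.a).mpr ⟨hsing.1, fun i => by
    fin_cases i
    · exact ha10
    · exact ha01⟩
  have hb_ge : 1 ≤ θ.b.order := one_le_order_iff_constCoeff_eq_zero.mpr hsing.2
  have hg20 : coeff (Finsupp.single 0 2) (X 0 * θ.b - X 1 * θ.a) ≠ 0 := by
    rw [coeff_g_two_zero]; exact hb10
  have hg0 : X 0 * θ.b - X 1 * θ.a ≠ 0 := fun h => hg20 (by rw [h, map_zero])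
  have hg_le : (X 0 * θ.b - X 1 * θ.a).order ≤ 2 := by
    have := order_le hg20; rwa [Finsupp.degree_single, Nat.cast_ofNat] at this
  obtain ⟨A, Bst, G, ma, mb, mg, s, α, β, hma, hmb, hmg, hmgb, hA, hKA, hνA, hB, hKB, hνB, hG, hKG, hνG,
    hsα, hsβ, hsat, ha', hb', hid, hfinAG, hμ'⟩ := exists_chart1_zero_setup θ θ' ha0 hb0 hg0 hsucc hiso'
  have h2a' : 2 ≤ ma := by rw [← hma] at h2a; exact_mod_cast h2a
  have hmb1 : 1 ≤ mb := by rw [← hmb] at hb_ge; exact_mod_cast hb_ge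
  have hmg2 : mg = 2 := by
    have h1 : 2 ≤ mg := by
      have : 1 ≤ min ma mb := le_min (by omega) hmb1
      omega
    have h2 : mg ≤ 2 := by rw [← hmg] at hg_le; exact_mod_cast hg_le
    omega
  have hβ0 : β = 0 := by omega
  rw [hβ0, pow_zero, one_mul] at hb'
  rw [hmg2] at hG
  have hG00 : constantCoeff G = coeff (Finsupp.single 0 2) (X 0 * θ.b - X 1 * θ.a) := by
    have h1 := coeff_subst_blow' (X 0 * θ.b - X 1 * θ.a) 2 0
    simp only [add_zero, Finsupp.single_zero] at h1
    have h2 := coeff_add_X_pow_mul 0 2 0 G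
    rw [add_zero, ← hG, h1, coeff_zero_eq_constantCoeff_apply] at h2
    exact h2.symm
  rintro ⟨-, hb0'⟩
  rw [hb', hG00] at hb0'
  exact hg20 hb0'

/-! ### The first step from an arbitrary type-N node -/

/-- **THE TYPE-N STEP, chart 1 at 0.**  If an isolated bad node `θ` with `linearPart ≠ 0` has a BAD isolated
chart-1-at-0 successor `θ'`, then `θ` is sheared (`a₁₀ = b₁₀ = b₀₁ = 0 ≠ a₀₁`; the other two
orientations have no bad successor in this chart), `3 ≤ μ(θ') ≤ μ(θ) + 1`, and
`linearPart θ' = [[0,0],[b₂₀,0]]`. [OURS · L1 W4.5c] -/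
theorem typeN_chart1_zero_step (θ θ' : PlanarField κ) (hiso : θ.IsIsolated) (hbad : θ.IsBadNode)
    (hL : θ.linearPart ≠ 0) (hsucc : IsSuccChart1 0 θ θ') (hiso' : θ'.IsIsolated) (hbad' : θ'.IsBadNode) :
    (θ.linearPart 0 0 = 0 ∧ θ.linearPart 0 1 ≠ 0 ∧ θ.linearPart 1 0 = 0 ∧ θ.linearPart 1 1 = 0) ∧
    θ'.milnor ≤ θ.milnor + 1 ∧ 3 ≤ θ'.milnor ∧
      θ'.linearPart = !![0, 0; coeff (Finsupp.single 0 2) θ.b, 0] := by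
  obtain ⟨hsing, hnil⟩ := hbad
  obtain ⟨htr, hdet⟩ := (isNilpotent_iff_trace_det _).mp hnil
  rw [Matrix.trace_fin_two] at htr
  rw [Matrix.det_fin_two] at hdet
  by_cases h01 : θ.linearPart 0 1 = 0
  · -- lower orientation: no bad successor in this chart
    exfalso
    rw [h01, zero_mul, sub_zero] at hdet
    have h00 : θ.linearPart 0 0 = 0 := by
      have h11 : θ.linearPart 1 1 = - θ.linearPart 0 0 := by linear_combination htr
      rw [h11, mul_neg, neg_eq_zero, mul_self_eq_zero] at hdet
      exact hdet
    have h11 : θ.linearPart 1 1 = 0 := by linear_combination htr - h00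
    have h10 : θ.linearPart 1 0 ≠ 0 := by
      intro h10
      apply hL
      ext i j
      fin_cases i <;> fin_cases j
      · exact h00
      · exact h01
      · exact h10
      · exact h11
    exact not_isSingular_of_lower θ θ' hiso hsing h00 h01 h10 hsucc hiso' hbad'.1
  · by_cases h00 : θ.linearPart 0 0 = 0
    · have h11 : θ.linearPart 1 1 = 0 := by linear_combination htr - h00
      have h10 : θ.linearPart 1 0 = 0 := by
        rw [h00, zero_mul, zero_sub, neg_eq_zero] at hdet
        rcases mul_eq_zero.mp hdet with h | h
        · exact absurd h h01
        · exact h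
      obtain ⟨h1, h2, -, h4⟩ := sheared_chart1_zero_step θ θ' hiso hsing h00 h01 h10 h11 hsucc hiso'
      exact ⟨⟨h00, h01, h10, h11⟩, h1, h2, h4⟩
    · exact absurd hbad' (not_isBadNode_of_linearPart_zero_zero_ne_zero θ θ' hiso hsing h01 h00 hsucc hiso')

/-- **THE TYPE-N STEP**, any successor: a bad isolated successor `θ'` of an isolated bad node `θ` with
`linearPart θ ≠ 0` satisfies `3 ≤ μ(θ') ≤ μ(θ) + 1` (via the B3 transport). First step of `NTwoExit` and of
`NStep`. [OURS · L1 W4.5c] -/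
theorem typeN_step (θ θ' : PlanarField κ) (hiso : θ.IsIsolated) (hbad : θ.IsBadNode)
    (hL : θ.linearPart ≠ 0) (hsucc : θ.IsSucc θ') (hiso' : θ'.IsIsolated) (hbad' : θ'.IsBadNode) :
    θ'.milnor ≤ θ.milnor + 1 ∧ 3 ≤ θ'.milnor := by
  revert hiso hbad hL hiso' hbad'
  refine forall_isSucc_of_chart1_zero
    (P := fun θ θ' => θ.IsIsolated → θ.IsBadNode → θ.linearPart ≠ 0 → θ'.IsIsolated → θ'.IsBadNode →
      θ'.milnor ≤ θ.milnor + 1 ∧ 3 ≤ θ'.milnor)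
    ?_ ?_ ?_ θ θ' hsucc
  · intro c θ θ' h hiso hbad hL hiso' hbad'
    have := h ((isIsolated_shear_iff c θ).mpr hiso) ((isBadNode_shear_iff c θ).mpr hbad)
      (fun h0 => hL ((linearPart_shear_eq_zero_iff c θ).mp h0)) hiso' hbad'
    rwa [milnor_shear] at this
  · intro θ θ' h hiso hbad hL hiso' hbad'
    have := h ((isIsolated_swapField_iff θ).mpr hiso) ((isBadNode_swapField_iff θ).mpr hbad)
      (fun h0 => hL ((linearPart_swapField_eq_zero_iff θ).mp h0)) ((isIsolated_swapField_iff θ').mpr hiso')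
      ((isBadNode_swapField_iff θ').mpr hbad')
    rwa [milnor_swapField, milnor_swapField] at this
  · intro θ θ' h hiso hbad hL hiso' hbad'
    obtain ⟨-, h1, h2, -⟩ := typeN_chart1_zero_step θ θ' hiso hbad hL h hiso' hbad'
    exact ⟨h1, h2⟩

end Summit.ResolutionOfSingularities.ResolutionOfSingularities.Theorems.WildQuotientResolution.S1.PlanarField

end
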